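import Mathlib
import Summits.NavierStokesRegularity.NavierStokesRegularity.Theorems.FilamentSkeletonRssTangentSkeletonNearStraightLPartnerSymbol
import Summits.NavierStokesRegularity.NavierStokesRegularity.Theorems.FilamentSkeletonRssTangentSkeletonNearStraightLBesselSharp

/-!
# Swirl-band decoupling (R♯-sw) `SwirlBandDecouplingL` — the partner kernel's symbol is exponentially small
# (`TangentSkeletonNearStraightL`, stmt-NavierStokesRegularity-23320, OPEN leaf of route `FilamentSkeletonRss`)

CONTEXT.  The registered line of the crux (`child_tangent_analytic_strip_L`, b0b56c52900dd90a) is down to its heart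
`stub_analyticClosingL` (⟺ `TangentSkeletonAnalyticL` once the retyped P2 p823048 and kernel-only P3 p824053 are referenced),
whose PHASE 2 is a Γ-uniform right inverse of the linearised tangency operator.  The crux strategist's census
(`Cruxes/SkeletonJ1L/STRATEGY-CENSUS.md` PART III, §Decomposition D5) cuts that linear heart (R♯) by BAND × COUPLING and types the
first piece, «provable now», verbatim:

  `(R♯-sw) SwirlBandDecouplingL : Prop := ∀ (d μ k : ℝ), 0 < μ → μ ≤ d → 0 ≤ k →
     |∫ σ, Real.cos (k*σ) * ((d^2 + σ^2) + μ^2)^(-(3:ℝ)/2)| ≤ 2 * (d^2+μ^2)⁻¹ * (1 + k*√(d^2+μ^2)) * Real.exp (-k*√(d^2+μ^2))`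

— «the inter-filament kernel's symbol is `2kK₁(k√(d²+μ²))/√(d²+μ²)`: exponentially small in the swirl band (`k ≥ μ⁻¹`,
`d ≥ ρ√Γ` ⇒ factor `e^{−0.16√Γ}` for the GP datum) … it makes the swirl band SINGLE-filament rigorously».  This file PROVES that
statement (`swirlBand_decoupling`, stated as a theorem with the census's text; no `def`), from the symbol identity
`…PartnerSymbol.integral_cos_mul_inv_rpow_three_halves_scale` and the sharp bound `…BesselSharp.Cint_le_sharp`
(`xK₁(x) ≤ (1+x)e^{−x}`), together with the two-sided-in-`k` form.

HONEST FRAMING: a MODEL-level lemma of the linear theory of a HYPOTHETICAL filament skeleton on the NEGATIVE side of a MODEL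
route.  It is NOT a registered stub of 23320 (the registered stubs are `stub_stripPropagation` — retyped /16 version proved
p823048 — and the XL heart `stub_analyticClosingL`); `TangentSkeletonNearStraightL` stays OPEN, and nothing here bears on
Navier–Stokes regularity or blow-up.  `--supports stmt-NavierStokesRegularity-23320`.
-/

set_option linter.dupNamespace false

noncomputable section

open Real Set MeasureTheory Filter Topology

namespace Summit.NavierStokesRegularity.NavierStokesRegularity.Theorems.TangentSkeletonNearStraightLSwirlBand

open Summit.NavierStokesRegularity.NavierStokesRegularity.Theorems.AnalyticStripLiaSymbol
open Summit.NavierStokesRegularity.NavierStokesRegularity.Theorems.AnalyticStripLiaSymbol.Numerics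

/-! ## §4  Swirl-band decoupling: the partner kernel's symbol is exponentially small -/

/-- **Exponential smallness of the partner symbol** (all real `k`, `D > 0`):
`|∫_ℝ cos(kσ)(σ²+D²)^{−3/2} dσ| ≤ (2/D²)·(1 + |k|D)·e^{−|k|D}` — the symbol IS `(2/D²)·(|k|D)K₁(|k|D)` and
`xK₁(x) ≤ (1+x)e^{−x}`. [folklore] -/
theorem abs_integral_cos_mul_inv_rpow_le {D : ℝ} (hD : 0 < D) (k : ℝ) :
    |∫ σ : ℝ, Real.cos (k * σ) * ((σ ^ 2 + D ^ 2) ^ (3 / 2 : ℝ))⁻¹|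
      ≤ 2 / D ^ 2 * (1 + |k| * D) * Real.exp (-(|k| * D)) := by
  rw [integral_cos_mul_inv_rpow_three_halves_scale hD k]
  have hp : 0 ≤ k ^ 2 * D ^ 2 / 4 := by positivity
  have hroot : √(k ^ 2 * D ^ 2 / 4) = |k| * D / 2 := by
    rw [show k ^ 2 * D ^ 2 / 4 = (|k| * D / 2) ^ 2 by rw [← sq_abs k]; ring]
    exact Real.sqrt_sq (by positivity)
  have hC := Cint_le_sharp hp
  rw [hroot] at hC
  have h2D : 0 < 2 / D ^ 2 := by positivity
  rw [abs_of_nonneg (mul_nonneg h2D.le (Cint_nonneg _))]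
  calc 2 / D ^ 2 * Cint (k ^ 2 * D ^ 2 / 4)
      ≤ 2 / D ^ 2 * ((1 + 2 * (|k| * D / 2)) * Real.exp (-(2 * (|k| * D / 2)))) :=
        mul_le_mul_of_nonneg_left hC h2D.le
    _ = 2 / D ^ 2 * (1 + |k| * D) * Real.exp (-(|k| * D)) := by ring_nf

/-- **(R♯-sw) `SwirlBandDecouplingL` — the typed MODEL statement of the strategist's D5 cut of the linear heart (R♯) of
`TangentSkeletonNearStraightL`** (Cruxes/SkeletonJ1L/STRATEGY-CENSUS.md PART III, verbatim): for core scale `0 < μ ≤ d`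
(`d` the distance to the partner filament) and wavenumber `k ≥ 0`, the inter-filament kernel's cosine symbol obeys
`|∫ cos(kσ)((d²+σ²)+μ²)^{−3/2} dσ| ≤ 2(d²+μ²)⁻¹(1 + k√(d²+μ²))·e^{−k√(d²+μ²)}` — exponentially small in the swirl band
`k ≥ μ⁻¹`, `d ≥ ρ√Γ`, which makes that band single-filament.  (The hypothesis `μ ≤ d` is not used; only `0 < d²+μ²`.)
[folklore; symbol `2kK₁(k√(d²+μ²))/√(d²+μ²)`, Watson §6.16, and `xK₁(x) ≤ (1+x)e^{−x}` = `Cint_le_sharp`] -/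
theorem swirlBand_decoupling : ∀ (d μ k : ℝ), 0 < μ → μ ≤ d → 0 ≤ k →
    |∫ σ, Real.cos (k * σ) * ((d ^ 2 + σ ^ 2) + μ ^ 2) ^ (-(3:ℝ) / 2)|
      ≤ 2 * (d ^ 2 + μ ^ 2)⁻¹ * (1 + k * √(d ^ 2 + μ ^ 2)) * Real.exp (-k * √(d ^ 2 + μ ^ 2)) := by
  intro d μ k hμ _ hk
  have hD2 : 0 < d ^ 2 + μ ^ 2 := by positivity
  have hD : 0 < √(d ^ 2 + μ ^ 2) := Real.sqrt_pos.mpr hD2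
  have hsq : √(d ^ 2 + μ ^ 2) ^ 2 = d ^ 2 + μ ^ 2 := Real.sq_sqrt hD2.le
  have hfun : (fun σ : ℝ => Real.cos (k * σ) * ((d ^ 2 + σ ^ 2) + μ ^ 2) ^ (-(3:ℝ) / 2))
      = fun σ : ℝ => Real.cos (k * σ) * ((σ ^ 2 + √(d ^ 2 + μ ^ 2) ^ 2) ^ (3 / 2 : ℝ))⁻¹ := by
    funext σ
    rw [hsq, show (d ^ 2 + σ ^ 2) + μ ^ 2 = σ ^ 2 + (d ^ 2 + μ ^ 2) by ring,
      show (-(3:ℝ) / 2) = -(3 / 2 : ℝ) by norm_num, Real.rpow_neg (by positivity)]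
  rw [hfun]
  have h := abs_integral_cos_mul_inv_rpow_le hD k
  rw [abs_of_nonneg hk, hsq] at h
  calc |∫ σ : ℝ, Real.cos (k * σ) * ((σ ^ 2 + √(d ^ 2 + μ ^ 2) ^ 2) ^ (3 / 2 : ℝ))⁻¹|
      ≤ 2 / (d ^ 2 + μ ^ 2) * (1 + k * √(d ^ 2 + μ ^ 2)) * Real.exp (-(k * √(d ^ 2 + μ ^ 2))) := by
        simpa [hsq] using h
    _ = 2 * (d ^ 2 + μ ^ 2)⁻¹ * (1 + k * √(d ^ 2 + μ ^ 2)) * Real.exp (-k * √(d ^ 2 + μ ^ 2)) := by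
        rw [div_eq_mul_inv, neg_mul]

/-- The same bound for every real `k` (evenness in `k`), in the census's kernel notation. [folklore] -/
theorem swirlBand_decoupling_abs {d μ : ℝ} (hD2 : 0 < d ^ 2 + μ ^ 2) (k : ℝ) :
    |∫ σ, Real.cos (k * σ) * ((d ^ 2 + σ ^ 2) + μ ^ 2) ^ (-(3:ℝ) / 2)|
      ≤ 2 * (d ^ 2 + μ ^ 2)⁻¹ * (1 + |k| * √(d ^ 2 + μ ^ 2)) * Real.exp (-|k| * √(d ^ 2 + μ ^ 2)) := by
  have hD : 0 < √(d ^ 2 + μ ^ 2) := Real.sqrt_pos.mpr hD2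
  have hsq : √(d ^ 2 + μ ^ 2) ^ 2 = d ^ 2 + μ ^ 2 := Real.sq_sqrt hD2.le
  have hfun : (fun σ : ℝ => Real.cos (k * σ) * ((d ^ 2 + σ ^ 2) + μ ^ 2) ^ (-(3:ℝ) / 2))
      = fun σ : ℝ => Real.cos (k * σ) * ((σ ^ 2 + √(d ^ 2 + μ ^ 2) ^ 2) ^ (3 / 2 : ℝ))⁻¹ := by
    funext σ
    rw [hsq, show (d ^ 2 + σ ^ 2) + μ ^ 2 = σ ^ 2 + (d ^ 2 + μ ^ 2) by ring,
      show (-(3:ℝ) / 2) = -(3 / 2 : ℝ) by norm_num, Real.rpow_neg (by positivity)]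
  rw [hfun]
  have h := abs_integral_cos_mul_inv_rpow_le hD k
  rw [hsq] at h
  calc |∫ σ : ℝ, Real.cos (k * σ) * ((σ ^ 2 + √(d ^ 2 + μ ^ 2) ^ 2) ^ (3 / 2 : ℝ))⁻¹|
      ≤ 2 / (d ^ 2 + μ ^ 2) * (1 + |k| * √(d ^ 2 + μ ^ 2)) * Real.exp (-(|k| * √(d ^ 2 + μ ^ 2))) := by
        simpa [hsq] using h
    _ = 2 * (d ^ 2 + μ ^ 2)⁻¹ * (1 + |k| * √(d ^ 2 + μ ^ 2)) * Real.exp (-|k| * √(d ^ 2 + μ ^ 2)) := by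
        rw [div_eq_mul_inv, neg_mul]

end Summit.NavierStokesRegularity.NavierStokesRegularity.Theorems.TangentSkeletonNearStraightLSwirlBand
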